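import Summits.MatrixMultiplication.MatrixMultiplication.Theorems.AbelianSTPPCensusGW2Defs

/-!
# Rule U11-GW2: soundness of the kernel checker `GW2.check`

Cell mm-stpp (rung F-M1), theory lane (seat mm-stpp-theory, gen 16).  `GW2.check k X Y Z S ca cb cc ds fuel = true` refutes
`GW2.GW2Adm (2k)` for every shape list with pair products `(P_AB, P_BC, P_CA) = (X, Y, Z)`, volume sum `Σ a b c = S` and letter maxima
`(ca, cb, cc)` (`GW2.not_gw2Adm_of_check`).  The checker bisects the cube of subgroup counts `(x, y, z)` into boxes and refutes each
box by ONE evaluation of monotone corner bounds; the key lemma is `GW2.lval_le`: the certified class bound `lval` evaluated at a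
componentwise SMALLER triple `(u₀, v₀, w₀) ≤ (u, v, w)` is a lower bound for the class count `n` of any `ClassOK k cap u v w n`
(pigeonhole and the Grynkiewicz–Wang floor are monotone, and an exclusion of the structural branch verified at `(u₀, v₀, w₀)` persists at
`(u, v, w)` because `GW2.sizeLB` is monotone and `k − w ≤ k − w₀`).  Definitions: `AbelianSTPPCensusGW2Defs.lean`; the rule's soundness
(`IsSTPP ⇒ GW2Adm`): `AbelianSTPPCensusGW2Sound.lean`; first kill: `AbelianSTPPCensusGW2Wall594.lean`.
WHAT THIS IS NOT: no census number, no `ω` statement; checker bookkeeping only.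
-/

set_option linter.dupNamespace false -- `MatrixMultiplication.MatrixMultiplication` (summit = problem, D-0017)
set_option autoImplicit false

namespace Summit.MatrixMultiplication.MatrixMultiplication.Theorems

open Finset

namespace GW2

/-! ### Monotonicity of the class bound -/

/-- `sizeLB` is monotone in the class sizes. [bookkeeping] -/
theorem sizeLB_mono {u u' v v' : ℕ} (hu : u ≤ u') (hv : v ≤ v') (h t : ℕ) : sizeLB u v h t ≤ sizeLB u' v' h t := by
  unfold sizeLB
  refine Nat.mul_le_mul_left h (Nat.div_le_div_right ?_)
  have : max (max (max u v) (u + v - h) + 1 - t) 1 ≤ max (max (max u' v') (u' + v' - h) + 1 - t) 1 := by omega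
  omega

/-- `h ≤ sizeLB u v h t` for `h ≥ 1` (the popular set is a non-empty union of cosets). [bookkeeping] -/
theorem le_sizeLB (u v t : ℕ) {h : ℕ} (hh : 1 ≤ h) : h ≤ sizeLB u v h t := by
  unfold sizeLB
  refine Nat.le_mul_of_pos_right h ?_
  apply Nat.div_pos _ hh
  omega

/-- The divisor list is complete: `divsOK k ds = true` gives every divisor `2 ≤ h ≤ k` of `k` in `ds`. [bookkeeping] -/
theorem mem_of_divsOK {k : ℕ} {ds : List ℕ} (hd : divsOK k ds = true) {h : ℕ} (h2 : 2 ≤ h) (hdvd : h ∣ k) (hk : h ≤ k) :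
    h ∈ ds := by
  unfold divsOK at hd
  rw [List.all_eq_true] at hd
  have := hd h (List.mem_range.mpr (by omega))
  simp only [Bool.or_eq_true, decide_eq_true_eq, Bool.not_eq_true', decide_eq_false_iff_not] at this
  rcases this with (h1 | h1) | h1
  · omega
  · exact absurd hdvd h1
  · exact h1

/-- **Corner bound.**  If the class `(u, v) → w` with count `n` is `ClassOK`, then the checker's bound at any componentwise smaller
triple is at most `n`: `lval k cap u₀ v₀ w₀ ds ≤ n` for `u₀ ≤ u`, `v₀ ≤ v`, `w₀ ≤ w` (`ds` a complete divisor list). [original] -/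
theorem lval_le {k cap u v w n u₀ v₀ w₀ : ℕ} {ds : List ℕ} (hC : ClassOK k cap u v w n)
    (hds : ∀ h, 2 ≤ h → h ∣ k → h ≤ k → h ∈ ds) (hu : u₀ ≤ u) (hv : v₀ ≤ v) (hw : w₀ ≤ w) :
    lval k cap u₀ v₀ w₀ ds ≤ n := by
  obtain ⟨-, -, hpig, hgw⟩ := hC
  dsimp only [lval]
  refine max_le ?_ ?_
  · refine le_trans ?_ hpig
    exact Nat.mul_le_mul hw (by omega)
  · split_ifs with hcond
    · obtain ⟨hct, htu, htv, hex⟩ := hcond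
      set t := tSel k cap u₀ v₀ w₀ ds with ht
      rcases hgw t hct (htu.trans hu) (htv.trans hv) with hfl | ⟨h, h2, hdk, hsz, -⟩
      · have h1 : t * (u₀ + v₀ + w₀) ≤ t * (u + v + w) := Nat.mul_le_mul_left t (by omega)
        omega
      · exfalso
        have hhk : h ≤ k := by
          have := le_sizeLB u v t (show 1 ≤ h by omega)
          omega
        have hmem : h ∈ ds := hds h h2 hdk hhk
        unfold exclAll at hex
        rw [List.all_eq_true] at hex
        have hx := hex h hmem
        unfold exclH at hx
        rw [decide_eq_true_eq] at hx
        have hmono := sizeLB_mono hu hv h t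
        omega
    · exact Nat.zero_le _

/-! ### One letter form on a box -/

/-- **A refuted box refutes every split in it (one letter form).** [original] -/
theorem formKilled_sound {k U V W S cap : ℕ} {ds : List ℕ} (hds : ∀ h, 2 ≤ h → h ∣ k → h ≤ k → h ∈ ds)
    {pl pu ql qu rl ru : ℕ} (hkill : formKilled k U V W S cap ds pl pu ql qu rl ru = true)
    {p q r : ℕ} (hp : pl ≤ p ∧ p ≤ pu) (hq : ql ≤ q ∧ q ≤ qu) (hr : rl ≤ r ∧ r ≤ ru) :
    ¬ FormOK k U V W S cap p q r := by
  intro hF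
  obtain ⟨-, -, -, -, -, -, -, -, -, n₀₀, n₁₁, n₀₁, n₁₀, hb0, hb1, htot, c00, c11, c01, c10⟩ := hF
  have l00 := lval_le (ds := ds) c00 hds hp.1 hq.1 hr.1
  have l11 := lval_le (ds := ds) c11 hds (tsub_le_tsub_left hp.2 U) (tsub_le_tsub_left hq.2 V) hr.1
  have l01 := lval_le (ds := ds) c01 hds hp.1 (tsub_le_tsub_left hq.2 V) (tsub_le_tsub_left hr.2 W)
  have l10 := lval_le (ds := ds) c10 hds (tsub_le_tsub_left hp.2 U) hq.1 (tsub_le_tsub_left hr.2 W)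
  have hUp : U - p ≤ U - pl := tsub_le_tsub_left hp.1 U
  have hVq : V - q ≤ V - ql := tsub_le_tsub_left hq.1 V
  have hWr : W - r ≤ W - rl := tsub_le_tsub_left hr.1 W
  have m00a : n₀₀ ≤ pu * qu := c00.1.trans (Nat.mul_le_mul hp.2 hq.2)
  have m00b : n₀₀ ≤ ru * min pu qu := c00.2.1.trans (Nat.mul_le_mul hr.2 (min_le_min hp.2 hq.2))
  have m11a : n₁₁ ≤ (U - pl) * (V - ql) := c11.1.trans (Nat.mul_le_mul hUp hVq)
  have m11b : n₁₁ ≤ ru * min (U - pl) (V - ql) := c11.2.1.trans (Nat.mul_le_mul hr.2 (min_le_min hUp hVq))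
  have m01a : n₀₁ ≤ pu * (V - ql) := c01.1.trans (Nat.mul_le_mul hp.2 hVq)
  have m01b : n₀₁ ≤ (W - rl) * min pu (V - ql) := c01.2.1.trans (Nat.mul_le_mul hWr (min_le_min hp.2 hVq))
  have m10a : n₁₀ ≤ (U - pl) * qu := c10.1.trans (Nat.mul_le_mul hUp hq.2)
  have m10b : n₁₀ ≤ (W - rl) * min (U - pl) qu := c10.2.1.trans (Nat.mul_le_mul hWr (min_le_min hUp hq.2))
  have hcr : cap * r ≤ cap * ru := Nat.mul_le_mul_left cap hr.2
  have hcW : cap * (W - r) ≤ cap * (W - rl) := Nat.mul_le_mul_left cap hWr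
  have e1 : min (pu * qu) (ru * min pu qu) ≥ n₀₀ := le_min m00a m00b
  have e2 : min ((U - pl) * (V - ql)) (ru * min (U - pl) (V - ql)) ≥ n₁₁ := le_min m11a m11b
  have e3 : min (pu * (V - ql)) ((W - rl) * min pu (V - ql)) ≥ n₀₁ := le_min m01a m01b
  have e4 : min ((U - pl) * qu) ((W - rl) * min (U - pl) qu) ≥ n₁₀ := le_min m10a m10b
  unfold formKilled at hkill
  simp only [Bool.or_eq_true, decide_eq_true_eq] at hkill
  generalize lval k cap pl ql rl ds = a00 at hkill l00
  generalize lval k cap (U - pu) (V - qu) rl ds = a11 at hkill l11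
  generalize lval k cap pl (V - qu) (W - ru) ds = a01 at hkill l01
  generalize lval k cap (U - pu) ql (W - ru) ds = a10 at hkill l10
  generalize min (pu * qu) (ru * min pu qu) = b00 at hkill e1
  generalize min ((U - pl) * (V - ql)) (ru * min (U - pl) (V - ql)) = b11 at hkill e2
  generalize min (pu * (V - ql)) ((W - rl) * min pu (V - ql)) = b01 at hkill e3
  generalize min ((U - pl) * qu) ((W - rl) * min (U - pl) qu) = b10 at hkill e4
  generalize cap * r = cr at hb0 hcr
  generalize cap * ru = cru at hkill hcr
  generalize cap * (W - r) = cwr at hb1 hcW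
  generalize cap * (W - rl) = cwrl at hkill hcW
  omega

/-- **A refuted box refutes every split in it (three letter forms).** [original] -/
theorem boxKilled_sound {k X Y Z S ca cb cc : ℕ} {ds : List ℕ} (hds : ∀ h, 2 ≤ h → h ∣ k → h ≤ k → h ∈ ds)
    {xl xu yl yu zl zu : ℕ} (hkill : boxKilled k X Y Z S ca cb cc ds xl xu yl yu zl zu = true)
    {x y z : ℕ} (hx : xl ≤ x ∧ x ≤ xu) (hy : yl ≤ y ∧ y ≤ yu) (hz : zl ≤ z ∧ z ≤ zu) :
    ¬ (FormOK k X Y Z S cb x y z ∧ FormOK k Z X Y S ca z x y ∧ FormOK k Y Z X S cc y z x) := by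
  rintro ⟨hB, hA, hC⟩
  unfold boxKilled at hkill
  simp only [Bool.or_eq_true] at hkill
  rcases hkill with (h1 | h1) | h1
  · exact formKilled_sound hds h1 hx hy hz hB
  · exact formKilled_sound hds h1 hz hx hy hA
  · exact formKilled_sound hds h1 hy hz hx hC

/-- **Soundness of the bisection.**  `certify … fuel box = true` refutes every split in the box. [original] -/
theorem certify_sound {k X Y Z S ca cb cc : ℕ} {ds : List ℕ} (hds : ∀ h, 2 ≤ h → h ∣ k → h ≤ k → h ∈ ds) (fuel : ℕ) :
    ∀ {xl xu yl yu zl zu : ℕ}, certify k X Y Z S ca cb cc ds fuel xl xu yl yu zl zu = true →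
      ∀ {x y z : ℕ}, xl ≤ x ∧ x ≤ xu → yl ≤ y ∧ y ≤ yu → zl ≤ z ∧ z ≤ zu →
        ¬ (FormOK k X Y Z S cb x y z ∧ FormOK k Z X Y S ca z x y ∧ FormOK k Y Z X S cc y z x) := by
  induction fuel with
  | zero =>
    intro xl xu yl yu zl zu hc x y z hx hy hz
    exact boxKilled_sound hds hc hx hy hz
  | succ fuel ih =>
    intro xl xu yl yu zl zu hc x y z hx hy hz
    unfold certify at hc
    rw [Bool.or_eq_true] at hc
    rcases hc with hb | hsplit
    · exact boxKilled_sound hds hb hx hy hz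
    · split_ifs at hsplit with h1 h2
      · simp only [Bool.and_eq_true, decide_eq_true_eq] at hsplit
        obtain ⟨⟨-, hc1⟩, hc2⟩ := hsplit
        by_cases hxm : x ≤ (xl + xu) / 2
        · exact ih hc1 ⟨hx.1, hxm⟩ hy hz
        · exact ih hc2 ⟨by omega, hx.2⟩ hy hz
      · simp only [Bool.and_eq_true, decide_eq_true_eq] at hsplit
        obtain ⟨⟨-, hc1⟩, hc2⟩ := hsplit
        by_cases hym : y ≤ (yl + yu) / 2
        · exact ih hc1 hx ⟨hy.1, hym⟩ hz
        · exact ih hc2 hx ⟨by omega, hy.2⟩ hz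
      · simp only [Bool.and_eq_true, decide_eq_true_eq] at hsplit
        obtain ⟨⟨-, hc1⟩, hc2⟩ := hsplit
        by_cases hzm : z ≤ (zl + zu) / 2
        · exact ih hc1 hx hy ⟨hz.1, hzm⟩
        · exact ih hc2 hx hy ⟨by omega, hz.2⟩

variable {N : ℕ}

/-- **Soundness of the checker.**  If `check k X Y Z S ca cb cc ds fuel = true` then no shape list with `P_AB = X`, `P_BC = Y`, `P_CA = Z`,
`Σ a b c = S`, `max a = ca`, `max b = cb`, `max c = cc` is `GW2Adm (2k)`: the actual subgroup counts `(x, y, z)` of form B lie in the root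
box (`X − k ≤ x ≤ min(X, k)` etc., from the class bounds of `FormOK`) and every split there is refuted (`certify_sound`). [original] -/
theorem not_gw2Adm_of_check {k X Y Z S ca cb cc fuel : ℕ} {ds : List ℕ}
    (hchk : check k X Y Z S ca cb cc ds fuel = true) {a b c : Fin N → ℕ}
    (hX : pAB a b c = X) (hY : pBC a b c = Y) (hZ : pCA a b c = Z) (hS : sV a b c = S)
    (ha : univ.sup a = ca) (hb : univ.sup b = cb) (hc : univ.sup c = cc) :
    ¬ GW2Adm (2 * k) a b c := by
  intro hadm
  obtain ⟨x, y, z, hB, hA, hC⟩ := hadm k rfl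
  subst hX hY hZ hS ha hb hc
  unfold check at hchk
  rw [Bool.and_eq_true] at hchk
  obtain ⟨hdiv, hcert⟩ := hchk
  have hds : ∀ h, 2 ≤ h → h ∣ k → h ≤ k → h ∈ ds := fun h h2 hdk hk => mem_of_divsOK hdiv h2 hdk hk
  obtain ⟨hxU, hyV, hzW, hxk, hUxk, hyk, hVyk, hzk, hWzk, -⟩ := id hB
  exact certify_sound hds fuel hcert ⟨by omega, le_min hxU hxk⟩ ⟨by omega, le_min hyV hyk⟩ ⟨by omega, le_min hzW hzk⟩
    ⟨hB, hA, hC⟩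

end GW2

end Summit.MatrixMultiplication.MatrixMultiplication.Theorems
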